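import Summits.MatrixMultiplication.OmegaCensus.DominoZ19StructSixArrA1
import Summits.MatrixMultiplication.OmegaCensus.DominoZ19StructSixArrA2
import Summits.MatrixMultiplication.OmegaCensus.DominoZ19StructSixArrA3
import Summits.MatrixMultiplication.OmegaCensus.DominoZ19StructSixArrA4
import Summits.MatrixMultiplication.OmegaCensus.DominoZ19StructSixArrA5
import Summits.MatrixMultiplication.OmegaCensus.DominoZ19StructSixArrA6
import HarnessLib

/-!
# The `y`-arrangement list of family `A` for the structural part-`6` route, `p = 19`: assembly

ω-census `pub-omega`, family (b3), seat pub-omega-group gen 25.  Framing: lottery ticket; floor = certified bounds/negative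
ranges.  VALUE: per-prime kernel data of the structural part-`6` route WITHOUT the pigeonhole (`DominoZpZpStructSixWide*.lean`)
for `p = 19` — target: the OPEN census cell `(1,6,20)@361` (`A = ℤ₁₉²`) and every larger order with such a quotient; NOT progress on ω.

`hysaZ19s6` (hypothesis `hYSa` of `exists_entry_structSixWide_of_checks`) from the per-representative decides.
-/

namespace Summit.MatrixMultiplication.OmegaCensus

open ZpZpDomino

namespace ZpZpDomino

/-- **Completeness of `ysaZ19s6`**: every `arr6Y3`-arrangement of every representative is listed. [folklore] -/
theorem hysaZ19s6 : ∀ k ∈ rZ19s6, ∀ ys ∈ arr6Y3 19 k, ys ∈ ysaZ19s6 := by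
  have h : ∀ k ∈ rZ19s6, ((arr6Y3 19 k).all fun ys => ysaZ19s6.contains ys) = true := by
    simp only [rZ19s6, List.forall_mem_cons]
    exact ⟨ysaZ19s6_c0, ysaZ19s6_c1, ysaZ19s6_c2, ysaZ19s6_c3, ysaZ19s6_c4, ysaZ19s6_c5, ysaZ19s6_c6, ysaZ19s6_c7, ysaZ19s6_c8, ysaZ19s6_c9, ysaZ19s6_c10, ysaZ19s6_c11, ysaZ19s6_c12, ysaZ19s6_c13, ysaZ19s6_c14, ysaZ19s6_c15, ysaZ19s6_c16, ysaZ19s6_c17, ysaZ19s6_c18, ysaZ19s6_c19, ysaZ19s6_c20, ysaZ19s6_c21, ysaZ19s6_c22, ysaZ19s6_c23, ysaZ19s6_c24, ysaZ19s6_c25, ysaZ19s6_c26, ysaZ19s6_c27, ysaZ19s6_c28, ysaZ19s6_c29, ysaZ19s6_c30, ysaZ19s6_c31, ysaZ19s6_c32, ysaZ19s6_c33, ysaZ19s6_c34, ysaZ19s6_c35, ysaZ19s6_c36, ysaZ19s6_c37, ysaZ19s6_c38, ysaZ19s6_c39, ysaZ19s6_c40, ysaZ19s6_c41, ysaZ19s6_c42,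 ysaZ19s6_c43, ysaZ19s6_c44, ysaZ19s6_c45, ysaZ19s6_c46, ysaZ19s6_c47, ysaZ19s6_c48, ysaZ19s6_c49, ysaZ19s6_c50, ysaZ19s6_c51, ysaZ19s6_c52, ysaZ19s6_c53, ysaZ19s6_c54, ysaZ19s6_c55, ysaZ19s6_c56, ysaZ19s6_c57, ysaZ19s6_c58, ysaZ19s6_c59, ysaZ19s6_c60, ysaZ19s6_c61, ysaZ19s6_c62, ysaZ19s6_c63, fun _ h => (List.not_mem_nil h).elim⟩
  intro k hk ys hys
  have := List.all_eq_true.1 (h k hk) ys hys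
  rwa [List.contains_iff_mem] at this

end ZpZpDomino

end Summit.MatrixMultiplication.OmegaCensus
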